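import Summits.HodgeConjecture.HodgeConjecture.Theorems.Ring2AbelianAllSpreadPerClass
import Summits.HodgeConjecture.HodgeConjecture.Theorems.Ring2AbelianAllStandardAPencilsTransport
import HarnessLib

/-!
# Ring 2 · §AbelianAll (seat `ab-spread-1`), XI — WHICH HYPOTHESIS IS SMALLER: the spread floor F_CM lies BELOW
# every André-axis candidate (the pencil nodes (1)–(4), (R631), (T∃), CPS_CM, and the standard-conjecture nodes
# A_pen, B_pen, (5)), by name, modulo exactly the named facts those candidates already need to close

HONEST FRAMING: research route, not a corollary; conditional on HC_CM plus one named minimal statement.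
(Cell line: research route conditional on HC_CM; not a corollary; Q11.4-sentence-2 already refuted in dim ≥ 3.)

Cell `pub-hodge-ring2`, sub-cell `ab-*` (ALL ABELIAN VARIETIES), seat `ab-spread-1`, gen 14; answers the brief's part
(ii) ("so the map shows both routes and WHICH HYPOTHESIS IS SMALLER") and REFEREE-AB R-28 (iii) ("three axes — F_CM,
A_pen^CM, Num^CM — without comparison theorems"). `HC_CM` = `Theses.RankFourFaces.CMAbelianHodge` (stmt-3052) is a
BINDER `hCM` in §C only and never a fact; `HC_AV` = `Theses.PadicSemiregularLift.HodgeAbelianVarieties` (stmt-1333);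
the item `Theses.RankFourFaces.CMToAbelian` (stmt-16267) is OPEN and nothing here closes it; nothing here is a case of
the Hodge conjecture; NO new node is minted (COUNT ONCE: every edge below is deform's, `ab-andre-1`'s or parts VI–VII's,
cited by name — this file only composes them into one-name comparison rows). Named facts, displayed as binders:
`h₂₁` = `andre1996_cmAnchoredPencil` (André 1996, Lemme 6.3.1), `h₈` = `Abdulali1994_invariantCycles_of_lefschetzStandard`
and `h₈A` = `Abdulali1994_invariantCycles_of_lefschetzStandardA` (Abdulali 1994 p. 1122 / Milne 2020 Prop. 1, the
latter with the hypothesis as printed; `h₈A ⟹ h₈` is `abdulali_lefschetzStandard_of_standardConjectureA`).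

## What is PROVED here (kernel-checked, sorry-free, `HC_CM`-free except §C)

* §A SPINE. `CPS_CM ⟹[h₂₁] FS_∃ ⟹ F_CM` and, FACT-FREE, `(T∃) ⟹ FS_∃ ⟹ F_CM`
  (`hodgeFailureSpreadsToCMFibre_of_cmAnchoredPencilTransport`): the per-class failure form F_CM
  (`HodgeFailureSpreadsToCMFibre`, part VII) is implied by André II's existential transport node with NO named fact.
* §B ROWS, one name each, concluding F_CM: from (4) `CMAnchoredTransport`, (L) `CMFibreAlgebraicLift`,
  (L∀) `AlgebraicFixedPart`, (3) `CMPointedPencilVHC`, (3c) `Deform.CMPointedCompactPencilVHC`, (R631)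
  `Deform.CMAnchoredPencilVHC`, (2) `Deform.CompactAbelianPencilVHC`, (1) `Hypotheses.AbelianSchemeVHC` — each mod `h₂₁`
  only; from A_pen^CM `CMPointedPencilStandardA` and A_pen∀ mod `h₈A, h₂₁`; from B_pen^CM `CMPointedPencilLefschetz`,
  (5) `LefschetzBCMPointedPencils` and B_pen∀ mod `h₈, h₂₁`. Summaries `spreadFloor_below_andreAxis` (ten rows, `h₂₁`)
  and `spreadFloor_below_standardConjectureNodes` (five rows, `h₈A`, `h₂₁`).
* §C UNDER `HC_CM` (binder) and mod `h₂₁` the EXACT nodes collapse onto F_CM: `F_CM ↔ (2) ↔ (3c) ↔ (R631) ↔ (4) ↔ (T∃)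
  ↔ CPS_∃ ↔ CPS_CM` (`floor_iff_exactAndreNodes_of_andre1996_of_HC_CM`, Frame I `iff_of_exactWithCM_of_HC_CM`).

## THE ANSWER TO "WHICH IS SMALLER" (honest column)

(a) ORDER: F_CM is the SMALLER hypothesis — every André-axis candidate implies it, modulo the same named fact(s) under
which that candidate closes at all (`h₂₁`; plus `h₈`/`h₈A` for the standard-conjecture nodes), and (T∃) implies it with
none. (b) NO CONVERSE is claimed or known: `F_CM ⟹ (4)` / `⟹ CPS_CM` are open without `HC_CM` (F_CM is vacuous given
`HC_AV`, the pencil nodes are not known to be); and `F_CM ⟹ A_pen^CM`, `⟹ B_pen^CM`, `⟹ (5)` are open EVEN GRANTED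
`HC_CM ∧ h₂₁ ∧ h₈A`, because those nodes assert Grothendieck's `A` / `B` on pencil TOTAL SPACES, which are not abelian
varieties — their only landed source is the full Hodge conjecture (`cmPointedPencilStandardA_of_hodgeConjecture`,
`cmPointedPencilLefschetz_of_hodgeConjecture`); they are SUFFICIENT complements (KIND 2, `HC_CM` load-bearing), not
known ON-PATH from `HC_AV`, whereas F_CM is EXACT fact-free (part VII `HC_AV_iff_HC_CM_and_hodgeFailureSpreadsToCMFibre`).
(c) SMALLER IS NOT DEEPER: F_CM's entire content beyond the item is its anchoring clause (part VII §E); A_pen^CM is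
the more WORKABLE statement (one finite-dimensional identity per CM-pointed pencil), F_CM the weaker one. The cell's
two routes are therefore ORDERED, not rival:
`A_pen^CM ⟹[h₈A] (3c) ⟹ CPS_CM ⟹[h₂₁] CPS_∃ ⟹ FS_∃ ⟹ FS_∃ᶜ ⟹ F_CM ⟹ CMToAbelian`.
(d) Num^CM (`ab-andre-2`'s numerical node: `Num^CM ∧ Perf ⟹ (L)` by `cmFibreAlgebraicLift_of_nondegenerate_of_numerical`)
enters this order AT (L); its one-name row `Num^CM ⟹ F_CM` is deferred until that node's `def` lands (not imported
here; no statement of another seat is re-typed). (e) "Minimal" is NOT claimed for F_CM (REFEREE-AB F-ab-4): least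
TYPED node of the diagram, not least sufficient complement — that remains the item.

References (bib keys): Andre1996Motifs (Lemme 6.3.1 p. 31, Remarque 2 and §6.3 a) p. 33); Abdulali1994FamiliesAV
((1.1) p. 1122, Lemma 6.2 p. 1131); Milne2020HodgeClassesAV (Prop. 1 p. 7); CharlesSchnell2014Notes (Conj. 11.3.1,
Cor. 11.3.6); Deligne1982HodgeCycles (Prop. 6.1); Grothendieck1968 (§3 p. 196).
-/

set_option linter.dupNamespace false

namespace Summit.HodgeConjecture.HodgeConjecture.Ring2.AbelianAll

open Literature.AlgebraicGeometry Literature.AlgebraicGeometry.Motives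
open Literature.AlgebraicGeometry.HodgeTheory
open Literature.AlgebraicGeometry.Abdulali1994 (Abdulali1994_invariantCycles_of_lefschetzStandard
  Abdulali1994_invariantCycles_of_lefschetzStandardA)
open Literature.AlgebraicGeometry.Andre1996 (andre1996_cmAnchoredPencil)
open Summit.HodgeConjecture.HodgeConjecture
open Summit.HodgeConjecture.HodgeConjecture.Theses
open Summit.HodgeConjecture.HodgeConjecture.Theses.RankFourFaces (CMAbelianHodge CMToAbelian)
open Summit.HodgeConjecture.HodgeConjecture.Theses.PadicSemiregularLift (HodgeAbelianVarieties)
open Summit.HodgeConjecture.HodgeConjecture.Ring2.Deform (CMPointedPencilCMSpreading CMAnchoredPencilCMSpreading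
  CompactAbelianPencilVHC CMPointedCompactPencilVHC CMAnchoredPencilVHC)
open Summit.HodgeConjecture.HodgeConjecture.Ring2.Hypotheses (AbelianSchemeVHC)

/-! ## §A The spine: CPS_CM and (T∃) down to the floor -/

/-- **CPS_CM ⟹ FS_∃ mod Lemme 6.3.1** (deform XIII `CPS_CM ⟹[h₂₁] CPS_∃`, then part VI `CPS_∃ ⟹ FS_∃`).
[cite: Andre1996Motifs, Lemme 6.3.1 (p. 31) and §6.3 a) (p. 33)] -/
theorem cmAnchoredFamilyCMSpreading_of_andre1996_of_cmPointedPencilCMSpreading (h₂₁ : andre1996_cmAnchoredPencil)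
    (hS : CMPointedPencilCMSpreading) : CMAnchoredFamilyCMSpreading :=
  cmAnchoredFamilyCMSpreading_of_cmAnchoredPencilCMSpreading
    (Ring2.Deform.cmAnchoredPencilCMSpreading_of_andre1996_of_cmPointedPencilCMSpreading h₂₁ hS)

/-- **CPS_CM ⟹ F_CM mod Lemme 6.3.1.** [cite: Andre1996Motifs, Lemme 6.3.1 (p. 31) and §6.3 a) (p. 33)] -/
theorem hodgeFailureSpreadsToCMFibre_of_andre1996_of_cmPointedPencilCMSpreading (h₂₁ : andre1996_cmAnchoredPencil)
    (hS : CMPointedPencilCMSpreading) : HodgeFailureSpreadsToCMFibre :=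
  hodgeFailureSpreadsToCMFibre_of_cmAnchoredFamilyCMSpreading
    (cmAnchoredFamilyCMSpreading_of_andre1996_of_cmPointedPencilCMSpreading h₂₁ hS)

/-- **(T∃) ⟹ FS_∃ with NO named fact** (deform XIII `(T∃) ⟹ CPS_∃`, part VI `CPS_∃ ⟹ FS_∃`).
[cite: Andre1996Motifs, §6.3 a) (p. 33)] -/
theorem cmAnchoredFamilyCMSpreading_of_cmAnchoredPencilTransport (hT : CMAnchoredPencilTransport) :
    CMAnchoredFamilyCMSpreading :=
  cmAnchoredFamilyCMSpreading_of_cmAnchoredPencilCMSpreading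
    (Ring2.Deform.cmAnchoredPencilCMSpreading_of_cmAnchoredPencilTransport hT)

/-- **(T∃) ⟹ F_CM with NO named fact**: the floor lies below André II's existential node unconditionally.
[cite: Andre1996Motifs, §6.3 a) (p. 33)] -/
theorem hodgeFailureSpreadsToCMFibre_of_cmAnchoredPencilTransport (hT : CMAnchoredPencilTransport) :
    HodgeFailureSpreadsToCMFibre :=
  hodgeFailureSpreadsToCMFibre_of_cmAnchoredFamilyCMSpreading (cmAnchoredFamilyCMSpreading_of_cmAnchoredPencilTransport hT)

/-! ## §B One-name rows from every André-axis node (all `HC_CM`-free) -/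

/-- **(4) ⟹ F_CM mod Lemme 6.3.1.** [cite: Andre1996Motifs, Lemme 6.3.1 (p. 31)] [cite: Abdulali1994FamiliesAV, Lemma 6.2 (p. 1131)] -/
theorem hodgeFailureSpreadsToCMFibre_of_andre1996_of_cmAnchoredTransport (h₂₁ : andre1996_cmAnchoredPencil)
    (h : CMAnchoredTransport) : HodgeFailureSpreadsToCMFibre :=
  hodgeFailureSpreadsToCMFibre_of_andre1996_of_cmPointedPencilCMSpreading h₂₁
    (Ring2.Deform.cmPointedPencilCMSpreading_of_cmAnchoredTransport h)

/-- **(L) ⟹ F_CM mod Lemme 6.3.1.** [cite: Andre1996Motifs, Lemme 6.3.1 (p. 31)] -/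
theorem hodgeFailureSpreadsToCMFibre_of_andre1996_of_cmFibreAlgebraicLift (h₂₁ : andre1996_cmAnchoredPencil)
    (h : CMFibreAlgebraicLift) : HodgeFailureSpreadsToCMFibre :=
  hodgeFailureSpreadsToCMFibre_of_andre1996_of_cmAnchoredTransport h₂₁ (cmAnchoredTransport_of_cmFibreAlgebraicLift h)

/-- **(L∀) ⟹ F_CM mod Lemme 6.3.1.** [cite: Andre1996Motifs, Lemme 6.3.1 (p. 31)] -/
theorem hodgeFailureSpreadsToCMFibre_of_andre1996_of_algebraicFixedPart (h₂₁ : andre1996_cmAnchoredPencil)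
    (h : AlgebraicFixedPart) : HodgeFailureSpreadsToCMFibre :=
  hodgeFailureSpreadsToCMFibre_of_andre1996_of_cmFibreAlgebraicLift h₂₁ (cmFibreAlgebraicLift_of_algebraicFixedPart h)

/-- **(3) ⟹ F_CM mod Lemme 6.3.1.** [cite: Andre1996Motifs, Lemme 6.3.1 (p. 31)] [cite: CharlesSchnell2014Notes, Conj. 11.3.1] -/
theorem hodgeFailureSpreadsToCMFibre_of_andre1996_of_cmPointedPencilVHC (h₂₁ : andre1996_cmAnchoredPencil)
    (h : CMPointedPencilVHC) : HodgeFailureSpreadsToCMFibre :=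
  hodgeFailureSpreadsToCMFibre_of_andre1996_of_cmAnchoredTransport h₂₁ (cmAnchoredTransport_of_cmPointedPencilVHC h)

/-- **(3c) ⟹ F_CM mod Lemme 6.3.1** (deform's compact-pencil form of (3)). [cite: Andre1996Motifs, Lemme 6.3.1 (p. 31)] -/
theorem hodgeFailureSpreadsToCMFibre_of_andre1996_of_cmPointedCompactPencilVHC (h₂₁ : andre1996_cmAnchoredPencil)
    (h : CMPointedCompactPencilVHC) : HodgeFailureSpreadsToCMFibre :=
  hodgeFailureSpreadsToCMFibre_of_andre1996_of_cmPointedPencilCMSpreading h₂₁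
    (Ring2.Deform.cmPointedPencilCMSpreading_of_cmPointedCompactPencilVHC h)

/-- **(R631) ⟹ F_CM mod Lemme 6.3.1** (Frame I `(R631) ⟹[h₂₁] (T∃)`, then §A fact-free). [cite: Andre1996Motifs, Lemme 6.3.1 (p. 31)] -/
theorem hodgeFailureSpreadsToCMFibre_of_andre1996_of_cmAnchoredPencilVHC (h₂₁ : andre1996_cmAnchoredPencil)
    (h : CMAnchoredPencilVHC) : HodgeFailureSpreadsToCMFibre :=
  hodgeFailureSpreadsToCMFibre_of_cmAnchoredPencilTransport (cmAnchoredPencilTransport_of_andre1996_of_cmAnchoredPencilVHC h₂₁ h)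

/-- **(2) ⟹ F_CM mod Lemme 6.3.1.** [cite: Andre1996Motifs, Lemme 6.3.1 (p. 31)] [cite: CharlesSchnell2014Notes, Conj. 11.3.1] -/
theorem hodgeFailureSpreadsToCMFibre_of_andre1996_of_compactAbelianPencilVHC (h₂₁ : andre1996_cmAnchoredPencil)
    (h : CompactAbelianPencilVHC) : HodgeFailureSpreadsToCMFibre :=
  hodgeFailureSpreadsToCMFibre_of_andre1996_of_cmPointedPencilCMSpreading h₂₁
    (Ring2.Deform.cmPointedPencilCMSpreading_of_compactAbelianPencilVHC h)

/-- **(1) ⟹ F_CM mod Lemme 6.3.1.** [cite: Andre1996Motifs, Lemme 6.3.1 (p. 31)] [cite: CharlesSchnell2014Notes, Conj. 11.3.1] -/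
theorem hodgeFailureSpreadsToCMFibre_of_andre1996_of_abelianSchemeVHC (h₂₁ : andre1996_cmAnchoredPencil)
    (h : AbelianSchemeVHC) : HodgeFailureSpreadsToCMFibre :=
  hodgeFailureSpreadsToCMFibre_of_andre1996_of_cmPointedPencilCMSpreading h₂₁
    (Ring2.Deform.cmPointedPencilCMSpreading_of_abelianSchemeVHC h)

/-- **A_pen^CM ⟹ F_CM mod Abdulali p. 1122 (hypothesis as printed) and Lemme 6.3.1** — the comparison theorem between the
cell's two routes: `ab-andre-1`'s standard-conjecture-A node implies the spread floor.
[cite: Abdulali1994FamiliesAV, (1.1) (p. 1122)] [cite: Milne2020HodgeClassesAV, Prop. 1 (p. 7)] [cite: Andre1996Motifs, Lemme 6.3.1 (p. 31)] -/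
theorem hodgeFailureSpreadsToCMFibre_of_abdulaliA_of_andre1996_of_cmPointedPencilStandardA
    (h₈A : Abdulali1994_invariantCycles_of_lefschetzStandardA) (h₂₁ : andre1996_cmAnchoredPencil)
    (hA : CMPointedPencilStandardA) : HodgeFailureSpreadsToCMFibre :=
  hodgeFailureSpreadsToCMFibre_of_andre1996_of_cmPointedCompactPencilVHC h₂₁
    (cmPointedCompactPencilVHC_of_abdulaliA_of_cmPointedPencilStandardA h₈A hA)

/-- **A_pen∀ ⟹ F_CM mod `h₈A`, `h₂₁`.** [cite: Abdulali1994FamiliesAV, (1.1) (p. 1122)] [cite: Andre1996Motifs, Lemme 6.3.1 (p. 31)] -/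
theorem hodgeFailureSpreadsToCMFibre_of_abdulaliA_of_andre1996_of_compactAbelianPencilStandardA
    (h₈A : Abdulali1994_invariantCycles_of_lefschetzStandardA) (h₂₁ : andre1996_cmAnchoredPencil)
    (hA : CompactAbelianPencilStandardA) : HodgeFailureSpreadsToCMFibre :=
  hodgeFailureSpreadsToCMFibre_of_abdulaliA_of_andre1996_of_cmPointedPencilStandardA h₈A h₂₁
    (cmPointedPencilStandardA_of_compactAbelianPencilStandardA hA)

/-- **B_pen^CM ⟹ F_CM mod Abdulali pp. 1122–1123 (`h₈`) and Lemme 6.3.1.**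
[cite: Abdulali1994FamiliesAV, (1.1) (pp. 1122–1123)] [cite: Andre1996Motifs, Lemme 6.3.1 (p. 31) and Remarque 2 (p. 33)] -/
theorem hodgeFailureSpreadsToCMFibre_of_abdulali_of_andre1996_of_cmPointedPencilLefschetz
    (h₈ : Abdulali1994_invariantCycles_of_lefschetzStandard) (h₂₁ : andre1996_cmAnchoredPencil)
    (hB : CMPointedPencilLefschetz) : HodgeFailureSpreadsToCMFibre :=
  hodgeFailureSpreadsToCMFibre_of_andre1996_of_cmPointedCompactPencilVHC h₂₁
    (cmPointedCompactPencilVHC_of_abdulali_of_cmPointedPencilLefschetz h₈ hB)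

/-- **(5) ⟹ F_CM mod `h₈`, `h₂₁`** ((5) `↔` B_pen^CM is `ab-andre-1`'s junction). [cite: Abdulali1994FamiliesAV, (1.1) (pp. 1122–1123)]
[cite: Andre1996Motifs, Lemme 6.3.1 (p. 31) and Remarque 2 (p. 33)] -/
theorem hodgeFailureSpreadsToCMFibre_of_abdulali_of_andre1996_of_lefschetzBCMPointedPencils
    (h₈ : Abdulali1994_invariantCycles_of_lefschetzStandard) (h₂₁ : andre1996_cmAnchoredPencil)
    (h5 : LefschetzBCMPointedPencils) : HodgeFailureSpreadsToCMFibre :=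
  hodgeFailureSpreadsToCMFibre_of_abdulali_of_andre1996_of_cmPointedPencilLefschetz h₈ h₂₁
    (lefschetzBCMPointedPencils_iff_cmPointedPencilLefschetz.1 h5)

/-- **B_pen∀ ⟹ F_CM mod `h₈`, `h₂₁`.** [cite: Abdulali1994FamiliesAV, (1.1) (pp. 1122–1123)]
[cite: Andre1996Motifs, Lemme 6.3.1 (p. 31)] -/
theorem hodgeFailureSpreadsToCMFibre_of_abdulali_of_andre1996_of_compactAbelianPencilLefschetz
    (h₈ : Abdulali1994_invariantCycles_of_lefschetzStandard) (h₂₁ : andre1996_cmAnchoredPencil)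
    (hB : CompactAbelianPencilLefschetz) : HodgeFailureSpreadsToCMFibre :=
  hodgeFailureSpreadsToCMFibre_of_abdulali_of_andre1996_of_cmPointedPencilLefschetz h₈ h₂₁
    (cmPointedPencilLefschetz_of_compactAbelianPencilLefschetz hB)

/-- **THE SPREAD FLOOR LIES BELOW ANDRÉ'S AXIS** (ten rows, mod Lemme 6.3.1 only; the (T∃) row uses no fact): from
(T∃), (R631), CPS_CM, (4), (L), (L∀), (3), (3c), (2), (1) to F_CM. No converse is claimed.
[cite: Andre1996Motifs, Lemme 6.3.1 (p. 31) and §6.3 (pp. 31–33)] [cite: CharlesSchnell2014Notes, Conj. 11.3.1] -/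
theorem spreadFloor_below_andreAxis (h₂₁ : andre1996_cmAnchoredPencil) :
    (CMAnchoredPencilTransport → HodgeFailureSpreadsToCMFibre) ∧ (CMAnchoredPencilVHC → HodgeFailureSpreadsToCMFibre) ∧
      (CMPointedPencilCMSpreading → HodgeFailureSpreadsToCMFibre) ∧ (CMAnchoredTransport → HodgeFailureSpreadsToCMFibre) ∧
      (CMFibreAlgebraicLift → HodgeFailureSpreadsToCMFibre) ∧ (AlgebraicFixedPart → HodgeFailureSpreadsToCMFibre) ∧
      (CMPointedPencilVHC → HodgeFailureSpreadsToCMFibre) ∧ (CMPointedCompactPencilVHC → HodgeFailureSpreadsToCMFibre) ∧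
      (CompactAbelianPencilVHC → HodgeFailureSpreadsToCMFibre) ∧ (AbelianSchemeVHC → HodgeFailureSpreadsToCMFibre) :=
  ⟨hodgeFailureSpreadsToCMFibre_of_cmAnchoredPencilTransport,
    hodgeFailureSpreadsToCMFibre_of_andre1996_of_cmAnchoredPencilVHC h₂₁,
    hodgeFailureSpreadsToCMFibre_of_andre1996_of_cmPointedPencilCMSpreading h₂₁,
    hodgeFailureSpreadsToCMFibre_of_andre1996_of_cmAnchoredTransport h₂₁,
    hodgeFailureSpreadsToCMFibre_of_andre1996_of_cmFibreAlgebraicLift h₂₁,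
    hodgeFailureSpreadsToCMFibre_of_andre1996_of_algebraicFixedPart h₂₁,
    hodgeFailureSpreadsToCMFibre_of_andre1996_of_cmPointedPencilVHC h₂₁,
    hodgeFailureSpreadsToCMFibre_of_andre1996_of_cmPointedCompactPencilVHC h₂₁,
    hodgeFailureSpreadsToCMFibre_of_andre1996_of_compactAbelianPencilVHC h₂₁,
    hodgeFailureSpreadsToCMFibre_of_andre1996_of_abelianSchemeVHC h₂₁⟩

/-- **THE SPREAD FLOOR LIES BELOW THE STANDARD-CONJECTURE NODES** (five rows, mod Abdulali p. 1122 with the hypothesis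
as printed — which gives the `⋆_L`-form fact by `abdulali_lefschetzStandard_of_standardConjectureA` — and Lemme 6.3.1):
from A_pen^CM, A_pen∀, B_pen^CM, (5), B_pen∀ to F_CM. No converse is claimed, even under `HC_CM` (header (b)).
[cite: Abdulali1994FamiliesAV, (1.1) (p. 1122)] [cite: Milne2020HodgeClassesAV, Prop. 1 (p. 7)]
[cite: Andre1996Motifs, Lemme 6.3.1 and Remarque 2 (pp. 31–33)] -/
theorem spreadFloor_below_standardConjectureNodes (h₈A : Abdulali1994_invariantCycles_of_lefschetzStandardA)
    (h₂₁ : andre1996_cmAnchoredPencil) :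
    (CMPointedPencilStandardA → HodgeFailureSpreadsToCMFibre) ∧ (CompactAbelianPencilStandardA → HodgeFailureSpreadsToCMFibre) ∧
      (CMPointedPencilLefschetz → HodgeFailureSpreadsToCMFibre) ∧ (LefschetzBCMPointedPencils → HodgeFailureSpreadsToCMFibre) ∧
      (CompactAbelianPencilLefschetz → HodgeFailureSpreadsToCMFibre) :=
  have h₈ := abdulali_lefschetzStandard_of_standardConjectureA h₈A
  ⟨hodgeFailureSpreadsToCMFibre_of_abdulaliA_of_andre1996_of_cmPointedPencilStandardA h₈A h₂₁,
    hodgeFailureSpreadsToCMFibre_of_abdulaliA_of_andre1996_of_compactAbelianPencilStandardA h₈A h₂₁,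
    hodgeFailureSpreadsToCMFibre_of_abdulali_of_andre1996_of_cmPointedPencilLefschetz h₈ h₂₁,
    hodgeFailureSpreadsToCMFibre_of_abdulali_of_andre1996_of_lefschetzBCMPointedPencils h₈ h₂₁,
    hodgeFailureSpreadsToCMFibre_of_abdulali_of_andre1996_of_compactAbelianPencilLefschetz h₈ h₂₁⟩

/-! ## §C Under `HC_CM` (a binder) the exact nodes collapse onto the floor -/

/-- **Under `HC_CM` and mod Lemme 6.3.1, F_CM IS each exact André node**: `F_CM ↔ (2) ↔ (3c) ↔ (R631) ↔ (4) ↔ (T∃) ↔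
CPS_∃ ↔ CPS_CM` (each is an exact complement of `HC_CM` — F_CM fact-free, part VII; the others mod `h₂₁`, Frame I/III —
and two exact complements agree under `HC_CM`, Frame I `iff_of_exactWithCM_of_HC_CM`). A_pen, B_pen, (5) are NOT in
this list: they are not known on-path from `HC_AV` (header (b)). [cite: Andre1996Motifs, Lemme 6.3.1 and Remarque 2 (pp. 31–33)] -/
theorem floor_iff_exactAndreNodes_of_andre1996_of_HC_CM (h₂₁ : andre1996_cmAnchoredPencil) (hCM : CMAbelianHodge) :
    (HodgeFailureSpreadsToCMFibre ↔ CompactAbelianPencilVHC) ∧ (HodgeFailureSpreadsToCMFibre ↔ CMPointedCompactPencilVHC) ∧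
      (HodgeFailureSpreadsToCMFibre ↔ CMAnchoredPencilVHC) ∧ (HodgeFailureSpreadsToCMFibre ↔ CMAnchoredTransport) ∧
      (HodgeFailureSpreadsToCMFibre ↔ CMAnchoredPencilTransport) ∧
      (HodgeFailureSpreadsToCMFibre ↔ CMAnchoredPencilCMSpreading) ∧
      (HodgeFailureSpreadsToCMFibre ↔ CMPointedPencilCMSpreading) :=
  have hF := exactWithCM_hodgeFailureSpreadsToCMFibre
  have hA := exactWithCM_candidates_of_andre1996 h₂₁
  have hS := exactWithCM_cmSpreading_of_andre1996 h₂₁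
  ⟨iff_of_exactWithCM_of_HC_CM hF hA.1 hCM, iff_of_exactWithCM_of_HC_CM hF hA.2.1 hCM,
    iff_of_exactWithCM_of_HC_CM hF hA.2.2.1 hCM, iff_of_exactWithCM_of_HC_CM hF hA.2.2.2.1 hCM,
    iff_of_exactWithCM_of_HC_CM hF hA.2.2.2.2 hCM, iff_of_exactWithCM_of_HC_CM hF hS.1 hCM,
    iff_of_exactWithCM_of_HC_CM hF hS.2 hCM⟩

/-- **Under `HC_CM` (binder), A_pen^CM still gives `HC_AV` THROUGH the floor** — the two routes composed: `ab-andre-1`'s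
node, this file's comparison row, part VII's closing row. The same conclusion as `ab-andre-1`'s direct KIND-2 row; recorded
to show the floor is a way-station of that route, not a rival. [cite: Abdulali1994FamiliesAV, (1.1) (p. 1122)]
[cite: Andre1996Motifs, Lemme 6.3.1 (p. 31)] -/
theorem HC_AV_of_HC_CM_of_abdulaliA_of_andre1996_of_cmPointedPencilStandardA_via_floor
    (h₈A : Abdulali1994_invariantCycles_of_lefschetzStandardA) (h₂₁ : andre1996_cmAnchoredPencil) (hCM : CMAbelianHodge)
    (hA : CMPointedPencilStandardA) : HodgeAbelianVarieties :=
  HC_AV_of_HC_CM_and_hodgeFailureSpreadsToCMFibre hCM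
    (hodgeFailureSpreadsToCMFibre_of_abdulaliA_of_andre1996_of_cmPointedPencilStandardA h₈A h₂₁ hA)

end Summit.HodgeConjecture.HodgeConjecture.Ring2.AbelianAll
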